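import Mathlib
import Literature.AlgebraicGeometry.Resolution.VPreparedLabelShear
import Literature.AlgebraicGeometry.Resolution.TotalPreparation
import Literature.AlgebraicGeometry.Resolution.CompletedChainPointStep
import HarnessLib

/-!
# The shear step of the transport down the completed chain (`τ = 1` endgame, brick R-4)

Topic: `Literature/AlgebraicGeometry/Resolution`. V. Cossart, U. Jannsen, S. Saito, LNM 2270 (2020),
Lemma 13.6 (`ũ₂ = u₂ − φ u₁`: «`v(f,y,u) = v(f,y,(u₁,ũ₂))` … if `(f,y,u)` is `v`-prepared, then so is
`(f,y,(u₁,ũ₂))`»), proof of Prop. 13.5 («the proof is reduced to the first case») and of Thm. 13.7 (p. 157,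
the complete case: «prepare `(f, y, (u₁, v₁))` to get a totally prepared label»), Thm. 8.24
[cite: CossartJannsenSaito2020, Lemma 13.6]; V. Cossart, O. Piltant, J. Algebra 320 (2008), proof of
Lemma 4.5 (2), p. 12 («we replace `(u₁, u₂, z)` by `(u₁, v₂ := u₂ + λu₁, z)` … If `Δ(E; u₁, v₂; z)` is not
prepared, we will change `z` to `w := z + θ` …») [cite: CossartPiltant2008, Lemma 4.5].

OURS (brick R-4 of the completed-chain descent, architecture OPTION R): in ONE complete three-dimensional
regular local ring (applied with `A = R̂_n` before a rational `(1 : a)` point step), a totally prepared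
adapted label `x = (ŷ, u, ŵ)` and a scalar `a` give a totally prepared adapted label
`x̃ = (ỹ, u, ŵ − a u)` — second slot unchanged, third slot sheared EXACTLY — with non-empty polygon, a
monic element, and THE SAME `α, β`. ASSEMBLY (no facts, no definitions) of `exists_prepared_label_shear`
(T1-shear), `TotalPreparation.exists_preparedUpTo_forall` (total preparation in a complete ring keeping
`α, β`) and `hasMonic_of_lt_deltaS`. F-71 / T1 / N2 NOT proved; no summit statement is proved.
AI-written; weaker than expert review.
-/

noncomputable section

open IsLocalRing MvPolynomial

namespace Literature.AlgebraicGeometry.Resolution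

universe u

section ShearStep

variable {A : Type u} [CommRing A] [IsRegularLocalRing A] [IsAdicComplete (maximalIdeal A) A]
  (x : Fin 3 → A) (hgen : Ideal.span {x 0, x 1, x 2} = maximalIdeal A) (hdim : ringKrullDim A = 3)
  {J : Ideal A} {μ : ℕ}

include hgen hdim in
/-- **R-4 (OURS). The shear step of the transport down the completed chain**: in a complete regular local
ring of dimension three, a totally prepared adapted label `x` of `(J, μ)` (`J ⊆ 𝔪^μ`, `J ⊄ 𝔪^{μ+1}`,
non-empty polygon, `L < δs`, `PreparedUpTo` for every bound) and a scalar `a` admit a totally prepared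
adapted label `x̃` with `x̃ 1 = x 1`, `x̃ 2 = x 2 − a · x 1`, non-empty polygon, `L < δs`, a monic element,
and `α(x̃) = α(x)`, `β(x̃) = β(x)`. [cite: CossartJannsenSaito2020, Lemma 13.6, Thm. 8.24]
[cite: CossartPiltant2008, Lemma 4.5 (2)] -/
theorem completedChain_shear (hJμ : J ≤ maximalIdeal A ^ μ) (hJne : ¬ J ≤ maximalIdeal A ^ (μ + 1))
    (hne : (pts x J μ).Nonempty) (hδ : μ.factorial < deltaS x J μ) (hprep : ∀ B, PreparedUpTo x J μ B)
    (a : A) :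
    ∃ xs : Fin 3 → A, xs 1 = x 1 ∧ xs 2 = x 2 - a * x 1 ∧
      Ideal.span {xs 0, xs 1, xs 2} = maximalIdeal A ∧ (∀ B, PreparedUpTo xs J μ B) ∧
      (pts xs J μ).Nonempty ∧ μ.factorial < deltaS xs J μ ∧ HasMonic xs J μ ∧
      alphaS xs J μ = alphaS x J μ ∧ betaS xs J μ = betaS x J μ := by
  classical
  have hvp : VPrepared x J μ :=
    vPrepared_of_preparedUpTo x hgen hdim hJμ hne (le_refl _) (hprep (alphaS x J μ))
  -- the shear `u₂ ↦ u₂ − a u₁` (CJS Lemma 13.6): `v`, `α`, `β` kept, `δ > L`, `v`-prepared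
  obtain ⟨z, -, hgen₁, hne₁, hα₁, hβ₁, hδ₁, hvp₁, -⟩ :=
    exists_prepared_label_shear x hgen hdim (-a) hJμ hne hδ hvp
  -- total preparation in the complete ring, keeping `α, β` and the slots `1, 2`
  obtain ⟨cs, hcs1, hcs2, -, -, hgens, -, hnes, hαs, hβs, -, hδs, hpreps⟩ :=
    exists_preparedUpTo_forall hdim (![z, x 1, x 2 + -a * x 1]) hgen₁ hne₁ hδ₁ hvp₁
  have hδs' : μ.factorial < deltaS cs J μ := lt_of_lt_of_le hδ₁ hδs
  refine ⟨cs, by rw [hcs1]; rfl, by rw [hcs2]; simp [neg_mul, sub_eq_add_neg], hgens, hpreps, hnes, hδs',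
    hasMonic_of_lt_deltaS cs hgens hdim hJμ hJne hδs', hαs.trans hα₁, hβs.trans hβ₁⟩

end ShearStep

end Literature.AlgebraicGeometry.Resolution

end
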